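import Literature.Probability.Percolation.InequalitiesProofs
import HarnessLib

/-!
# The van den Berg–Kesten inequality for a union of disjoint occurrences (vdBK 1985, (3.6))

Topic `Literature/Probability/Percolation`; a strengthening of the tree's `bk_inequality_cube`
(`InequalitiesProofs.lean`). Sources: J. van den Berg, H. Kesten, *Inequalities with applications to
percolation and reliability*, J. Appl. Probab. 22 (1985) 556–569, eq. (3.6) [vandenBergKestenJAP1985]
(not held; read through the verbatim restatement in) N. Gladkov, *Percolation inequalities and
decision trees*, arXiv:2408.08457 (2024), **Theorem 8.3** (p. 15) [Gladkov2024]: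

"**Theorem 8.3** ([BK85, eq. (3.6)]). Let `A₁, …, A_n` and `B₁, …, B_n` be increasing events on
`{0,1}^E`. Then `P(A₁ □ B₁ ∪ ⋯ ∪ A_n □ B_n) ≤ P(A₁ × B₁ ∪ ⋯ ∪ A_n × B_n)`, where the second event
is a subset of `{00, 01, 10, 11}^E` with the probability measure as in Theorem 8.2" (i.e. the
product of two independent copies; Gladkov's Theorem 8.4 is the decision-tree refinement, and the
mechanism is the four-case analysis of his Theorem 8.2, pp. 14–15).

We prove it on the weighted cube of `bk_inequality_cube` (finite coordinate type `α`, product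
weight `W(x) = ∏ᵢ wᵢ(xᵢ)`, `wᵢ ≥ 0`; any index type `τ` for the pairs of increasing events):
`W(Γ) · W(⋃_t A_t ∘ B_t) ≤ (W ⊗ W)(⋃_t A_t × B_t)` (`union_bk_cube`), by running the tree's
Grimmett coupling chain (`bkCube_sum_pair_split`, `bkCube_four_point`, `bkCube_step_false`,
`bkCube_step_true`, `bkCube_mem_empty`, `bkCube_mem_univ`) for the UNION of the coupled events
`E_S` of the pairs `(A_t, B_t)`: each one-coordinate step of the chain is witnessed inside a single
pair, so the case analysis transfers verbatim (`unionCube_sum_mono`). For one pair this is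
`bk_inequality_cube` (`W ⊗ W (A × B) = W(A) W(B)`).

Not transcribed: the `prodBernoulli` / bond-percolation transport (as in `ProdBernoulliBK.lean`; the
right-hand side is a probability under the product of two copies) and Gladkov's decision-tree
refinement Thm. 8.4.
-/

namespace Literature.Probability.Percolation

open Finset Function

section Cube

variable {α : Type*} [Fintype α] [DecidableEq α] {τ : Type*}

section Coupling

/-! The union over `t : τ` of the coupled events of the pairs `(A t, B t)`; hypothesis `hE` as in
`InequalitiesProofs.lean`, one family `E t` per pair. -/

variable {A B : τ → Set (α → Bool)} {E : τ → Finset α → Set ((α → Bool) × (α → Bool))}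
  (hE : ∀ (t : τ) (S : Finset α) (xy : (α → Bool) × (α → Bool)), xy ∈ E t S ↔
    ∃ K L : α → Bool, K ≤ xy.1 ∧ (∀ i ∈ S, L i ≤ xy.2 i) ∧ (∀ i ∉ S, L i ≤ xy.1 i) ∧
      (∀ i, K i = true → L i = true → i ∈ S) ∧ K ∈ A t ∧ L ∈ B t)
  {S : Finset α} {k : α}

include hE

/-- **The coupling inequality for the union** (Gladkov 2024, proof of Thm. 8.2, cases 1–4, run for
`A₁ ⊳⊲ B₁ ∪ ⋯`; vdBK 1985 (3.6)): moving one more coordinate `k` of the `B`-witnesses to the second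
copy does not decrease the weight of `⋃_t E_t(S)`. Each configuration in the union is in some
`E_t(S)`, where the one-pair steps `bkCube_step_false` / `bkCube_step_true` apply.
[cite: Gladkov2024, Thm. 8.2–8.4 (proof)] [cite: vandenBergKestenJAP1985, eq. (3.6)] -/
theorem unionCube_sum_mono (w : α → Bool → ℝ) (hw : ∀ i b, 0 ≤ w i b) (hk : k ∉ S) :
    ∑ xy, {xy | ∃ t, xy ∈ E t S}.indicator
        (fun xy : (α → Bool) × (α → Bool) => (∏ i, w i (xy.1 i)) * ∏ i, w i (xy.2 i)) xy ≤
      ∑ xy, {xy | ∃ t, xy ∈ E t (insert k S)}.indicator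
        (fun xy : (α → Bool) × (α → Bool) => (∏ i, w i (xy.1 i)) * ∏ i, w i (xy.2 i)) xy := by
  classical
  rw [bkCube_sum_pair_split k,
    bkCube_sum_pair_split k ({xy | ∃ t, xy ∈ E t (insert k S)}.indicator _)]
  refine Finset.sum_le_sum fun xy _ => ?_
  split_ifs with hxy
  · obtain ⟨x, y⟩ := xy
    set m : ℝ := (∏ i ∈ univ.erase k, w i (x i)) * ∏ i ∈ univ.erase k, w i (y i) with hm_def
    have hm : 0 ≤ m :=
      mul_nonneg (Finset.prod_nonneg fun i _ => hw i _) (Finset.prod_nonneg fun i _ => hw i _)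
    have hval : ∀ b c : Bool, (∏ i, w i (update x k b i)) * ∏ i, w i (update y k c i) =
        w k b * w k c * m := by
      intro b c
      rw [bkCube_prod_update, bkCube_prod_update, hm_def]
      ring
    have hind : ∀ (T : Set ((α → Bool) × (α → Bool))) (b c : Bool),
        0 ≤ T.indicator (fun xy : (α → Bool) × (α → Bool) =>
            (∏ i, w i (xy.1 i)) * ∏ i, w i (xy.2 i)) (update x k b, update y k c) ∧
          T.indicator (fun xy : (α → Bool) × (α → Bool) =>
            (∏ i, w i (xy.1 i)) * ∏ i, w i (xy.2 i)) (update x k b, update y k c) ≤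
            w k b * w k c * m := by
      intro T b c
      have h0 : 0 ≤ w k b * w k c * m := mul_nonneg (mul_nonneg (hw k b) (hw k c)) hm
      by_cases hT : (update x k b, update y k c) ∈ T
      · rw [Set.indicator_of_mem hT, hval]
        exact ⟨h0, le_rfl⟩
      · rw [Set.indicator_of_notMem hT]
        exact ⟨le_rfl, h0⟩
    refine bkCube_four_point (hind _) (hind _) ?_ ?_
    · rintro ⟨c, hc⟩ b' c'
      obtain ⟨t, hmem⟩ := Set.mem_of_indicator_ne_zero hc
      have h' : (update x k b', update y k c') ∈ {xy | ∃ t, xy ∈ E t (insert k S)} :=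
        ⟨t, bkCube_step_false (hE t) hk hmem b' c'⟩
      rw [Set.indicator_of_mem h', hval]
    · rintro ⟨c, hc⟩
      obtain ⟨t, hmem⟩ := Set.mem_of_indicator_ne_zero hc
      rcases bkCube_step_true (hE t) hk hmem with h | h
      · refine Or.inl fun c' => ?_
        have h' : (update x k true, update y k c') ∈ {xy | ∃ t, xy ∈ E t (insert k S)} := ⟨t, h c'⟩
        rw [Set.indicator_of_mem h', hval]
      · refine Or.inr fun b' => ?_
        have h' : (update x k b', update y k true) ∈ {xy | ∃ t, xy ∈ E t (insert k S)} := ⟨t, h b'⟩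
        rw [Set.indicator_of_mem h', hval]
  · exact le_rfl

/-- Iterating the coupling inequality for the union from `S = ∅`. [cite: Gladkov2024, Thm. 8.2–8.4 (proof)] -/
theorem unionCube_sum_empty_le (w : α → Bool → ℝ) (hw : ∀ i b, 0 ≤ w i b) (S : Finset α) :
    ∑ xy, {xy | ∃ t, xy ∈ E t ∅}.indicator
        (fun xy : (α → Bool) × (α → Bool) => (∏ i, w i (xy.1 i)) * ∏ i, w i (xy.2 i)) xy ≤
      ∑ xy, {xy | ∃ t, xy ∈ E t S}.indicator
        (fun xy : (α → Bool) × (α → Bool) => (∏ i, w i (xy.1 i)) * ∏ i, w i (xy.2 i)) xy := by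
  induction S using Finset.induction_on with
  | empty => exact le_rfl
  | insert k S hk ih => exact ih.trans (unionCube_sum_mono hE w hw hk)

/-- **The two ends of the union chain**: `⋃_t E_t(∅) = (⋃_t A_t ∘ B_t) × Γ` (`bkCube_mem_empty`)
and `⋃_t E_t(univ) = ⋃_t A_t × B_t` (`bkCube_mem_univ`), so the chain reads
`W(⋃_t A_t ∘ B_t) · W(Γ) ≤ (W ⊗ W)(⋃_t A_t × B_t)`. [cite: Gladkov2024, Thm. 8.3] [cite: vandenBergKestenJAP1985, eq. (3.6)] -/
theorem unionCube_weight_le (w : α → Bool → ℝ) (hw : ∀ i b, 0 ≤ w i b)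
    (hA : ∀ t, IsUpperSet (A t)) (hB : ∀ t, IsUpperSet (B t)) :
    (∑ x : α → Bool, ∏ i, w i (x i)) *
        ∑ x, {x : α → Bool | ∃ t, ∃ K L : α → Bool, K ≤ x ∧ L ≤ x ∧
          (∀ i, K i = true → L i = true → False) ∧ K ∈ A t ∧ L ∈ B t}.indicator
            (fun x => ∏ i, w i (x i)) x ≤
      ∑ xy, {xy : (α → Bool) × (α → Bool) | ∃ t, xy.1 ∈ A t ∧ xy.2 ∈ B t}.indicator
        (fun xy => (∏ i, w i (xy.1 i)) * ∏ i, w i (xy.2 i)) xy := by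
  classical
  have key := unionCube_sum_empty_le hE w hw Finset.univ
  have hl : ∑ xy, {xy | ∃ t, xy ∈ E t ∅}.indicator
      (fun xy : (α → Bool) × (α → Bool) => (∏ i, w i (xy.1 i)) * ∏ i, w i (xy.2 i)) xy =
      (∑ x, {x : α → Bool | ∃ t, ∃ K L : α → Bool, K ≤ x ∧ L ≤ x ∧
          (∀ i, K i = true → L i = true → False) ∧ K ∈ A t ∧ L ∈ B t}.indicator
            (fun x => ∏ i, w i (x i)) x) * ∑ x : α → Bool, ∏ i, w i (x i) := by
    rw [Fintype.sum_prod_type, Finset.sum_mul]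
    refine Finset.sum_congr rfl fun x _ => ?_
    rw [Finset.mul_sum]
    refine Finset.sum_congr rfl fun y _ => ?_
    have hiff : (x, y) ∈ {xy : (α → Bool) × (α → Bool) | ∃ t, xy ∈ E t ∅} ↔
        x ∈ {x : α → Bool | ∃ t, ∃ K L : α → Bool, K ≤ x ∧ L ≤ x ∧
          (∀ i, K i = true → L i = true → False) ∧ K ∈ A t ∧ L ∈ B t} := by
      simp only [Set.mem_setOf_eq]
      exact exists_congr fun t => bkCube_mem_empty (hE t) x y
    simp only [Set.indicator_apply, hiff]
    split_ifs <;> simp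
  have hr : ∑ xy, {xy | ∃ t, xy ∈ E t Finset.univ}.indicator
      (fun xy : (α → Bool) × (α → Bool) => (∏ i, w i (xy.1 i)) * ∏ i, w i (xy.2 i)) xy =
      ∑ xy, {xy : (α → Bool) × (α → Bool) | ∃ t, xy.1 ∈ A t ∧ xy.2 ∈ B t}.indicator
        (fun xy => (∏ i, w i (xy.1 i)) * ∏ i, w i (xy.2 i)) xy := by
    refine Finset.sum_congr rfl fun xy _ => ?_
    obtain ⟨x, y⟩ := xy
    have hiff : (x, y) ∈ {xy : (α → Bool) × (α → Bool) | ∃ t, xy ∈ E t Finset.univ} ↔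
        (x, y) ∈ {xy : (α → Bool) × (α → Bool) | ∃ t, xy.1 ∈ A t ∧ xy.2 ∈ B t} := by
      simp only [Set.mem_setOf_eq]
      exact exists_congr fun t => bkCube_mem_univ (hE t) (hA t) (hB t) x y
    simp only [Set.indicator_apply, hiff]
  rw [hl, hr] at key
  linarith [key]

end Coupling

/-- **The BK inequality for a union of disjoint occurrences on the weighted cube** (van den
Berg–Kesten 1985, eq. (3.6); Gladkov 2024, Thm. 8.3: "Let `A₁, …, A_n` and `B₁, …, B_n` be
increasing events on `{0,1}^E`. Then `P(A₁ □ B₁ ∪ ⋯ ∪ A_n □ B_n) ≤ P(A₁ × B₁ ∪ ⋯ ∪ A_n × B_n)`",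
the right-hand side under two independent copies). For `α` finite, a product weight
`W(x) = ∏ᵢ wᵢ(xᵢ)`, `wᵢ ≥ 0`, and increasing `A_t, B_t ⊆ {0,1}^α` (`t : τ`, any index type):
`W(Γ) · W(⋃_t A_t ∘ B_t) ≤ (W ⊗ W)(⋃_t A_t × B_t)`, with `A ∘ B` the disjoint occurrence of
`bk_inequality_cube` (disjoint sub-configurations). For probability weights `W(Γ) = 1` this is the
printed statement; for a single pair it is `bk_inequality_cube`.
[cite: vandenBergKestenJAP1985, eq. (3.6)] [cite: Gladkov2024, Thm. 8.3] -/
theorem union_bk_cube (w : α → Bool → ℝ) (hw : ∀ i b, 0 ≤ w i b) {A B : τ → Set (α → Bool)}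
    (hA : ∀ t, IsUpperSet (A t)) (hB : ∀ t, IsUpperSet (B t)) :
    (∑ x : α → Bool, ∏ i, w i (x i)) *
        ∑ x, {x : α → Bool | ∃ t, ∃ K L : α → Bool, K ≤ x ∧ L ≤ x ∧
          (∀ i, K i = true → L i = true → False) ∧ K ∈ A t ∧ L ∈ B t}.indicator
            (fun x => ∏ i, w i (x i)) x ≤
      ∑ xy, {xy : (α → Bool) × (α → Bool) | ∃ t, xy.1 ∈ A t ∧ xy.2 ∈ B t}.indicator
        (fun xy => (∏ i, w i (xy.1 i)) * ∏ i, w i (xy.2 i)) xy :=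
  unionCube_weight_le
    (E := fun t S => {xy : (α → Bool) × (α → Bool) | ∃ K L : α → Bool, K ≤ xy.1 ∧
      (∀ i ∈ S, L i ≤ xy.2 i) ∧ (∀ i ∉ S, L i ≤ xy.1 i) ∧
      (∀ i, K i = true → L i = true → i ∈ S) ∧ K ∈ A t ∧ L ∈ B t})
    (fun _ _ _ => Iff.rfl) w hw hA hB

end Cube

end Literature.Probability.Percolation
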